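import Literature.AlgebraicGeometry.Resolution.SmoothBaseChangeField
import Literature.AlgebraicGeometry.Resolution.RegularLocalRingsNormal
import Mathlib.RingTheory.LocalRing.ResidueField.Ideal
import HarnessLib

/-!
# Smooth points, constant field extensions and normalization

Topic: `Literature/AlgebraicGeometry/Resolution`. Second auxiliary file for Step 4 of the proof
of Temkin's Thm. 4.1.1 (M. Temkin, *Inseparable local uniformization*, J. Algebra 373 (2013)
65–119 = arXiv:0804.1554v3, p. 49: "Next, we extend `k̄` as follows: replace `k̄`, `mᵢ`, `K`,
`Kᵢ` with `l̄`, `l̄mᵢ`, `l̄K`, `l̄Kᵢ`, respectively; replace `Y`, `Yᵢ`, `X`, `Xᵢ` with their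
normalizations in these fields … In particular, `x₁` is `l`-smooth, and, replacing `l` with a
purely inseparable extension, we can also arrange that `x₁` is a simple `l`-smooth point").
After `SmoothBaseChangeField.lean` has made the base change `l′ ⊗_l T` of an affine variety
`T` smooth (regular with separable residue field) at the relevant point, this file passes from
the base change to the NORMALIZATION `N = Nr_{E}(T·l′)` of the image `T·l′ ⊆ E` of `l′ ⊗_l T`
in the enlarged function field `E`: at a point where `l′ ⊗_l T` is `l′`-smooth the two have the
same local ring. Everything is PROVED:

* the multiplication map `ψ : l′ ⊗_l T → E` (any `l′`-algebra map which is `T → E` on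
  `1 ⊗ T`, `map_tmul_eq_of_map_one_tmul`) has nil kernel
  (`isNilpotent_of_map_eq_zero_of_map_one_tmul`, `l′/l` purely inseparable).
* `exists_algEquiv_localization_of_map_one_tmul` — for an `l′`-subalgebra `N ⊆ E` containing
  the image of `l′ ⊗ T`, integral over `T`, with `E = Frac(T·l′)`, and a prime `P ⊂ N` whose
  pull-back `Q ⊂ l′ ⊗_l T` is an `l′`-smooth point: `N_P ≅ (l′ ⊗_l T)_Q` as `l′`-algebras (the
  regular local ring `(l′ ⊗ T)_Q` kills the nil kernel, embeds into `E` as a normal local domain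
  containing `N`, and its maximal ideal contracts to `P`). Corollaries
  `isRegularLocalRing_of_map_one_tmul`, `isSmoothAt_of_map_one_tmul`,
  `formallySmooth_residueField_of_map_one_tmul`: `P` is a (simple) `l′`-smooth regular point
  of `N` as soon as `Q` is one of `l′ ⊗_l T`.
* `adjoin_residueField_baseChange_eq_top` — the residue field of `l′ ⊗_l A` at a prime `Q` is
  generated over the residue field of `A` at `Q ∩ A` by the image of `l′`, so that
  `exists_purelyInseparable_formallySmooth_compositum` applies to it
  (`formallySmooth_residueField_baseChange_of_compositum`).
* `formallySmooth_of_ringEquiv_base` — formal smoothness is insensitive to replacing the base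
  ring by an isomorphic one.

## Sources

* M. Temkin, *Inseparable local uniformization*, arXiv:0804.1554v3, proof of Thm. 4.1.1, Step 4
  (p. 49). The commutative algebra is folklore.
-/

noncomputable section

namespace Literature.AlgebraicGeometry.Resolution

universe u

open IsLocalRing TensorProduct

/-! ### The multiplication map `l′ ⊗_l T → E` -/

section ConstantsMap

variable {l l' : Type u} [Field l] [Field l'] [Algebra l l']
  {T : Type u} [CommRing T] [Algebra l T]
  {E : Type u} [Field E] [Algebra T E] [Algebra l' E]
  (ψ : l' ⊗[l] T →ₐ[l'] E)
  (hψ : ∀ t : T, ψ ((1 : l') ⊗ₜ[l] t) = algebraMap T E t)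

include hψ in
/-- An `l′`-algebra map `ψ : l′ ⊗_l T → E` which is the structure map `T → E` on `1 ⊗ T` is
the multiplication map `c ⊗ t ↦ c·t` (its image is the ring `T·l′ = T[l′]` generated by `T`
and `l′`). [folklore] -/
theorem map_tmul_eq_of_map_one_tmul (c : l') (t : T) :
    ψ (c ⊗ₜ[l] t) = algebraMap l' E c * algebraMap T E t := by
  have : c ⊗ₜ[l] t = c • ((1 : l') ⊗ₜ[l] t) := by
    rw [TensorProduct.smul_tmul', smul_eq_mul, mul_one]
  rw [this, map_smul, hψ, Algebra.smul_def]

variable [IsPurelyInseparable l l'] [FaithfulSMul T E]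

include hψ in
/-- For `l′/l` purely inseparable and `T → E` injective, the kernel of the multiplication map
`l′ ⊗_l T → E` is nil (`qⁿ`-th powers land in `1 ⊗ T`). [folklore] -/
theorem isNilpotent_of_map_eq_zero_of_map_one_tmul {z : l' ⊗[l] T} (hz : ψ z = 0) :
    IsNilpotent z := by
  obtain ⟨q, hq⟩ := ExpChar.exists l
  obtain ⟨n, t, ht⟩ := exists_pow_mem_range_includeRight T q z
  have h2 : ψ (z ^ q ^ n) = 0 := by
    rw [map_pow, hz, zero_pow (pow_ne_zero n (expChar_pos l q).ne')]
  rw [← ht] at h2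
  have h1 : algebraMap T E t = 0 := by
    rw [← hψ t]
    exact h2
  have ht0 : t = 0 := FaithfulSMul.algebraMap_injective T E (by rw [h1, map_zero])
  refine ⟨q ^ n, ?_⟩
  rw [← ht, ht0, map_zero]

end ConstantsMap

/-! ### From the base change to the normalization of `T·l′` -/

section Normalization

variable {l l' : Type u} [Field l] [Field l'] [Algebra l l'] [IsPurelyInseparable l l']
  {T : Type u} [CommRing T] [Algebra l T] [Algebra.FiniteType l T]
  {E : Type u} [Field E] [Algebra T E] [FaithfulSMul T E] [Algebra l' E]
  (ψ : l' ⊗[l] T →ₐ[l'] E) (hψ : ∀ t : T, ψ ((1 : l') ⊗ₜ[l] t) = algebraMap T E t)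
  (N : Subalgebra l' E) (hψN : ∀ z, ψ z ∈ N)
  (hNint : ∀ n ∈ N, IsIntegral T n)
  (hfrac : ∀ e : E, ∃ a b : l' ⊗[l] T, ψ b ≠ 0 ∧ e * ψ b = ψ a)
  (P : Ideal N) [P.IsPrime]
  (hQ : Algebra.IsSmoothAt l' (P.comap (ψ.codRestrict N hψN).toRingHom))

include hψ hNint hfrac hQ in
/-- **The normalization has the local ring of the base change at a smooth point.** Let `T` be
an affine algebra over the field `l`, `T ⊆ E` a field, `l′/l` purely inseparable with a
compatible `l′ → E` such that `E = Frac(T·l′)`, and `N ⊆ E` an `l′`-subalgebra containing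
`T·l′` and integral over `T` (e.g. the integral closure of `T·l′` in `E`). If `P ⊂ N` is a prime
whose pull-back `Q ⊂ l′ ⊗_l T` is an `l′`-smooth point, then `N_P ≅ (l′ ⊗_l T)_Q` over `l′`:
`(l′ ⊗_l T)_Q` is regular, hence a normal domain in which the nil kernel of `l′ ⊗_l T → E`
dies, so it embeds into `E` as a normal local domain `S ⊇ T·l′` with `Frac S = E`; then
`N ⊆ S`, the maximal ideal of `S` contracts to `P`, and `S = N_P`. (Temkin 2013, proof of
Thm. 4.1.1, Step 4, p. 49: replacing `X` by its normalization in `l̄K` keeps the `l`-smooth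
point.) (`T` is automatically a domain, being embedded in the field `E`.) [folklore] -/
theorem exists_algEquiv_localization_of_map_one_tmul :
    Nonempty (Localization.AtPrime P ≃ₐ[l']
      Localization.AtPrime (P.comap (ψ.codRestrict N hψN).toRingHom)) := by
  classical
  set ψN : l' ⊗[l] T →ₐ[l'] N := ψ.codRestrict N hψN with hψNdef
  set Q : Ideal (l' ⊗[l] T) := P.comap ψN.toRingHom with hQdef
  have hψN_val : ∀ z, (ψN z : E) = ψ z := fun _ => rfl
  have hmemQ : ∀ z, z ∈ Q ↔ ψN z ∈ P := fun _ => Iff.rfl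
  -- `(l′ ⊗ T)_Q` is regular, hence a domain
  haveI : Algebra.FinitePresentation l T := (Algebra.FinitePresentation.of_finiteType).mp ‹_›
  haveI : Algebra.FinitePresentation l' (l' ⊗[l] T) := inferInstance
  haveI : Algebra.IsSmoothAt l' Q := hQ
  haveI hregQ : IsRegularLocalRing (Localization.AtPrime Q) :=
    isRegularLocalRing_of_isSmoothAt l' (l' ⊗[l] T) Q
  haveI : IsDomain (Localization.AtPrime Q) := isDomain_of_isRegularLocalRing _
  -- the nil kernel dies in `(l′ ⊗ T)_Q`
  have hloc : ∀ a b : l' ⊗[l] T, ψ a = ψ b → ∃ u : Q.primeCompl, (u : l' ⊗[l] T) * a = u * b := by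
    intro a b hab
    have hnil : IsNilpotent (a - b) :=
      isNilpotent_of_map_eq_zero_of_map_one_tmul ψ hψ (by rw [map_sub]; exact sub_eq_zero.mpr hab)
    have h0 : algebraMap (l' ⊗[l] T) (Localization.AtPrime Q) (a - b) = 0 :=
      (hnil.map _).eq_zero
    obtain ⟨u, hu⟩ := (IsLocalization.map_eq_zero_iff Q.primeCompl _ _).mp h0
    exact ⟨u, by rwa [mul_sub, sub_eq_zero] at hu⟩
  -- `ψ` inverts `Q.primeCompl`, hence extends to `θ : (l′ ⊗ T)_Q → E`, which is injective
  have hunit : ∀ s : Q.primeCompl, IsUnit (ψ s) := fun s => by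
    refine Ne.isUnit fun h0 => s.2 (show (s : l' ⊗[l] T) ∈ Q from ?_)
    rw [hmemQ]
    have : ψN s = 0 := Subtype.ext (by rw [hψN_val]; exact h0)
    rw [this]
    exact P.zero_mem
  let θ : Localization.AtPrime Q →ₐ[l'] E :=
    IsLocalization.liftAlgHom (M := Q.primeCompl) (f := ψ) hunit
  have hθalg : ∀ a, θ (algebraMap _ _ a) = ψ a := fun a => IsLocalization.lift_eq hunit a
  have hθmk : ∀ (a : l' ⊗[l] T) (s : Q.primeCompl),
      θ (IsLocalization.mk' _ a s) = ψ a * (ψ s)⁻¹ := fun a s => by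
    change IsLocalization.lift hunit (IsLocalization.mk' _ a s) = _
    rw [IsLocalization.lift_mk'_spec]
    change ψ a = ψ s * (ψ a * (ψ s)⁻¹)
    rw [mul_comm, inv_mul_cancel_right₀ (hunit s).ne_zero]
  have hθinj : Function.Injective θ := by
    rw [injective_iff_map_eq_zero]
    intro y hy
    obtain ⟨a, s, rfl⟩ := IsLocalization.exists_mk'_eq Q.primeCompl y
    rw [hθmk] at hy
    have ha : ψ a = 0 := by
      rcases mul_eq_zero.mp hy with h | h
      · exact h
      · exact absurd h (inv_ne_zero (hunit s).ne_zero)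
    obtain ⟨u, hu⟩ := hloc a 0 (by rw [ha, map_zero])
    rw [IsLocalization.mk'_eq_zero_iff]
    exact ⟨u, by rwa [mul_zero] at hu⟩
  -- `θ_N : N_P → E`, also injective
  have hunitN : ∀ s : P.primeCompl, IsUnit ((s : N) : E) := fun s =>
    Ne.isUnit fun h0 => s.2 (by
      have : (s : N) = 0 := Subtype.ext h0
      rw [this]
      exact P.zero_mem)
  let θN : Localization.AtPrime P →ₐ[l'] E :=
    IsLocalization.liftAlgHom (M := P.primeCompl) (f := N.val) hunitN
  have hθNmk : ∀ (n : N) (s : P.primeCompl),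
      θN (IsLocalization.mk' _ n s) = (n : E) * ((s : N) : E)⁻¹ := fun n s => by
    change IsLocalization.lift hunitN (IsLocalization.mk' _ n s) = _
    rw [IsLocalization.lift_mk'_spec]
    change (n : E) = ((s : N) : E) * ((n : E) * ((s : N) : E)⁻¹)
    rw [mul_comm, inv_mul_cancel_right₀ (hunitN s).ne_zero]
  have hθNinj : Function.Injective θN := by
    rw [injective_iff_map_eq_zero]
    intro y hy
    obtain ⟨n, s, rfl⟩ := IsLocalization.exists_mk'_eq P.primeCompl y
    rw [hθNmk] at hy
    have hn : (n : E) = 0 := by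
      rcases mul_eq_zero.mp hy with h | h
      · exact h
      · exact absurd h (inv_ne_zero (hunitN s).ne_zero)
    have hn0 : n = 0 := Subtype.ext hn
    rw [hn0, IsLocalization.mk'_zero]
  -- `S = θ((l′ ⊗ T)_Q)`: a regular, hence normal, local domain with fraction field `E`
  let eθ : Localization.AtPrime Q ≃ₐ[l'] θ.range := AlgEquiv.ofInjective θ hθinj
  haveI hregS : IsRegularLocalRing θ.range := IsRegularLocalRing.of_ringEquiv eθ.toRingEquiv
  haveI : IsIntegrallyClosed θ.range := isIntegrallyClosed_of_isRegularLocalRing _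
  have hψS : ∀ a, ψ a ∈ θ.range := fun a => ⟨algebraMap _ _ a, hθalg a⟩
  haveI : IsFractionRing θ.range E := by
    refine IsFractionRing.of_field θ.range E fun z => ?_
    obtain ⟨a, b, hb, hz⟩ := hfrac z
    refine ⟨⟨ψ a, hψS a⟩, ⟨ψ b, hψS b⟩, ?_⟩
    change z = ψ a / ψ b
    rw [eq_div_iff hb, hz]
  -- `T ⊆ S` and `N ⊆ S`
  have hT_S : ∀ t : T, algebraMap T E t ∈ θ.range := fun t => by
    rw [← hψ t]
    exact hψS _
  letI : Algebra T θ.range := ((algebraMap T E).codRestrict θ.range hT_S).toAlgebra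
  haveI : IsScalarTower T θ.range E := IsScalarTower.of_algebraMap_eq fun _ => rfl
  have hN_S : ∀ n ∈ N, n ∈ θ.range := fun n hn => by
    have hint : IsIntegral θ.range n := (hNint n hn).tower_top
    obtain ⟨y, hy⟩ := IsIntegrallyClosed.algebraMap_eq_of_integral hint
    rw [← hy]
    exact y.2
  -- elements of `N ∖ P` are units of `S`
  have hunit_S : ∀ s : N, s ∉ P → IsUnit (⟨(s : E), hN_S s s.2⟩ : θ.range) := by
    intro s hs
    by_contra hns
    set y := eθ.symm ⟨(s : E), hN_S s s.2⟩ with hydef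
    have hy : y ∈ maximalIdeal (Localization.AtPrime Q) :=
      (IsLocalRing.mem_maximalIdeal _).mpr fun hu => hns (by
        have := hu.map eθ
        rwa [hydef, AlgEquiv.apply_symm_apply] at this)
    obtain ⟨a, t, hat⟩ := IsLocalization.exists_mk'_eq Q.primeCompl y
    have haQ : a ∈ Q := (IsLocalization.AtPrime.mk'_mem_maximal_iff _ Q a t).mp (hat ▸ hy)
    have hval : θ y = (s : E) := by
      have := congrArg (fun w : θ.range => (w : E)) (AlgEquiv.apply_symm_apply eθ ⟨(s : E), hN_S s s.2⟩)
      rw [← hydef] at this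
      rw [← this]
      exact (AlgEquiv.ofInjective_apply θ hθinj y).symm
    rw [← hat, hθmk] at hval
    -- `s · ψ t = ψ a` in `N`, with `ψ a ∈ P`, `ψ t ∉ P`
    have hE : (s : E) * ψ t = ψ a := by
      rw [← hval, inv_mul_cancel_right₀ (hunit t).ne_zero]
    have hN' : s * ψN t = ψN a := Subtype.ext (by
      rw [Subalgebra.coe_mul, hψN_val, hψN_val]
      exact hE)
    have haP : ψN a ∈ P := (hmemQ a).mp haQ
    have htP : ψN t ∉ P := fun h => t.2 ((hmemQ t).mpr h)
    rw [← hN'] at haP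
    rcases (‹P.IsPrime›.mem_or_mem haP) with h | h
    · exact hs h
    · exact htP h
  -- the ranges agree: `N_P = S`
  have hrange : θN.range = θ.range := by
    apply le_antisymm
    · rintro _ ⟨y, rfl⟩
      obtain ⟨n, s, rfl⟩ := IsLocalization.exists_mk'_eq P.primeCompl y
      change θN (IsLocalization.mk' _ n s) ∈ θ.range
      rw [hθNmk]
      obtain ⟨us, hus⟩ := hunit_S (s : N) s.2
      have hinv : ((s : N) : E)⁻¹ = ((us⁻¹ : (θ.range)ˣ) : θ.range) := by
        symm
        apply eq_inv_of_mul_eq_one_right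
        have := congrArg (fun w : θ.range => (w : E)) us.mul_inv
        rw [Subalgebra.coe_mul, hus] at this
        exact this
      rw [hinv]
      exact Subalgebra.mul_mem _ (hN_S n n.2) (us⁻¹ : (θ.range)ˣ).val.2
    · rintro _ ⟨y, rfl⟩
      obtain ⟨a, s, rfl⟩ := IsLocalization.exists_mk'_eq Q.primeCompl y
      change θ (IsLocalization.mk' _ a s) ∈ θN.range
      rw [hθmk]
      have hsP : ψN s ∈ P.primeCompl := fun h => s.2 ((hmemQ s).mpr h)
      refine ⟨IsLocalization.mk' _ (ψN a) (⟨ψN s, hsP⟩ : P.primeCompl), ?_⟩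
      change θN (IsLocalization.mk' _ (ψN a) (⟨ψN s, hsP⟩ : P.primeCompl)) = _
      rw [hθNmk]
      rfl
  let eN : Localization.AtPrime P ≃ₐ[l'] θN.range := AlgEquiv.ofInjective θN hθNinj
  exact ⟨eN.trans ((Subalgebra.equivOfEq _ _ hrange).trans eθ.symm)⟩

include hψ hNint hfrac hQ in
/-- In the situation of `exists_algEquiv_localization_of_map_one_tmul`: `N` is regular at `P`.
[folklore] -/
theorem isRegularLocalRing_of_map_one_tmul : IsRegularLocalRing (Localization.AtPrime P) := by
  obtain ⟨e⟩ := exists_algEquiv_localization_of_map_one_tmul ψ hψ N hψN hNint hfrac P hQ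
  haveI : Algebra.FinitePresentation l T := (Algebra.FinitePresentation.of_finiteType).mp ‹_›
  haveI : Algebra.FinitePresentation l' (l' ⊗[l] T) := inferInstance
  haveI : Algebra.IsSmoothAt l' _ := hQ
  haveI := isRegularLocalRing_of_isSmoothAt l' (l' ⊗[l] T)
    (P.comap (ψ.codRestrict N hψN).toRingHom)
  exact IsRegularLocalRing.of_ringEquiv e.symm.toRingEquiv

include hψ hNint hfrac hQ in
/-- In the situation of `exists_algEquiv_localization_of_map_one_tmul`: `N` is `l′`-smooth at
`P`. [folklore] -/
theorem isSmoothAt_of_map_one_tmul : Algebra.IsSmoothAt l' P := by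
  obtain ⟨e⟩ := exists_algEquiv_localization_of_map_one_tmul ψ hψ N hψN hNint hfrac P hQ
  haveI : Algebra.FormallySmooth l' (Localization.AtPrime
    (P.comap (ψ.codRestrict N hψN).toRingHom)) := hQ
  exact Algebra.FormallySmooth.of_equiv e.symm

include hψ hNint hfrac hQ in
/-- In the situation of `exists_algEquiv_localization_of_map_one_tmul`: the residue fields of
`N` at `P` and of `l′ ⊗_l T` at `Q` are isomorphic over `l′`; in particular `P` is a SIMPLE
point (residue field formally smooth = separable over `l′`) when `Q` is. [folklore] -/
theorem formallySmooth_residueField_of_map_one_tmul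
    (h : Algebra.FormallySmooth l' (ResidueField (Localization.AtPrime
      (P.comap (ψ.codRestrict N hψN).toRingHom)))) :
    Algebra.FormallySmooth l' (ResidueField (Localization.AtPrime P)) := by
  obtain ⟨e⟩ := exists_algEquiv_localization_of_map_one_tmul ψ hψ N hψN hNint hfrac P hQ
  haveI := h
  exact Algebra.FormallySmooth.of_equiv (IsLocalRing.ResidueField.mapAlgEquiv e.symm)

end Normalization

/-! ### The residue field of a base change is a compositum -/

section ResidueFieldBaseChange

variable {l l' : Type u} [Field l] [Field l'] [Algebra l l'] (A : Type u) [CommRing A]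
  [Algebra l A] (Q : Ideal (l' ⊗[l] A)) [Q.IsPrime] (x : Ideal A) [x.IsPrime]
  (hx : x = Q.comap (Algebra.TensorProduct.includeRight (R := l) (A := l') :
    A →ₐ[l] l' ⊗[l] A).toRingHom)

/-- The tower `l → l′ → κ(Q)` for a prime `Q` of `l′ ⊗_l A`. [folklore] -/
theorem isScalarTower_left_residueField_baseChange :
    IsScalarTower l l' Q.ResidueField :=
  IsScalarTower.of_algebraMap_eq fun c => by
    rw [IsScalarTower.algebraMap_apply l' (l' ⊗[l] A) Q.ResidueField,
      ← IsScalarTower.algebraMap_apply l l' (l' ⊗[l] A),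
      ← IsScalarTower.algebraMap_apply l (l' ⊗[l] A) Q.ResidueField]

/-- The tower `l → κ(x) → κ(Q)` for a prime `Q` of `l′ ⊗_l A` over the prime `x` of `A`, with
`κ(x) → κ(Q)` the canonical map of residue fields. [folklore] -/
theorem isScalarTower_residueField_baseChange :
    letI : Algebra x.ResidueField Q.ResidueField :=
      (Ideal.ResidueField.map x Q (Algebra.TensorProduct.includeRight (R := l) (A := l') :
        A →ₐ[l] l' ⊗[l] A).toRingHom hx).toAlgebra
    IsScalarTower l x.ResidueField Q.ResidueField := by
  set ι := (Algebra.TensorProduct.includeRight (R := l) (A := l') : A →ₐ[l] l' ⊗[l] A).toRingHom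
    with hιdef
  letI inst : Algebra x.ResidueField Q.ResidueField := (Ideal.ResidueField.map x Q ι hx).toAlgebra
  refine IsScalarTower.of_algebraMap_eq fun c => ?_
  have hρ : algebraMap x.ResidueField Q.ResidueField (algebraMap A x.ResidueField
      (algebraMap l A c)) = algebraMap (l' ⊗[l] A) Q.ResidueField (ι (algebraMap l A c)) :=
    Ideal.ResidueField.map_algebraMap x Q ι hx _
  have hι : ι (algebraMap l A c) = algebraMap l (l' ⊗[l] A) c :=
    (Algebra.TensorProduct.includeRight (R := l) (A := l') : A →ₐ[l] l' ⊗[l] A).commutes c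
  rw [IsScalarTower.algebraMap_apply l A x.ResidueField, hρ, hι,
    ← IsScalarTower.algebraMap_apply l (l' ⊗[l] A) Q.ResidueField]

/-- For an algebraic extension `l′/l`, an `l`-algebra `A` and a prime `Q` of `l′ ⊗_l A` over
the prime `x` of `A`, the residue field `κ(Q)` is generated over `κ(x)` by the image of `l′`
(as a ring: `l′` is algebraic). [folklore] -/
theorem adjoin_residueField_baseChange_eq_top [Algebra.IsAlgebraic l l'] :
    letI : Algebra x.ResidueField Q.ResidueField :=
      (Ideal.ResidueField.map x Q (Algebra.TensorProduct.includeRight (R := l) (A := l') :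
        A →ₐ[l] l' ⊗[l] A).toRingHom hx).toAlgebra
    Algebra.adjoin x.ResidueField (Set.range (algebraMap l' Q.ResidueField)) = ⊤ := by
  set ι := (Algebra.TensorProduct.includeRight (R := l) (A := l') : A →ₐ[l] l' ⊗[l] A).toRingHom
    with hιdef
  letI inst : Algebra x.ResidueField Q.ResidueField := (Ideal.ResidueField.map x Q ι hx).toAlgebra
  set κ := x.ResidueField
  have hρ : ∀ a : A, algebraMap κ Q.ResidueField (algebraMap A κ a) =
      algebraMap (l' ⊗[l] A) Q.ResidueField (ι a) := fun a =>
    Ideal.ResidueField.map_algebraMap x Q ι hx a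
  -- the towers `l → κ → κ(Q)` and `l → l′ → κ(Q)`
  haveI : IsScalarTower l κ Q.ResidueField := isScalarTower_residueField_baseChange A Q x hx
  haveI : IsScalarTower l l' Q.ResidueField := isScalarTower_left_residueField_baseChange A Q
  -- the generators are algebraic over `κ`, so the ring they generate is a field
  have halg : ∀ y ∈ Set.range (algebraMap l' Q.ResidueField), IsAlgebraic κ y := by
    rintro _ ⟨c, rfl⟩
    have h1 : IsAlgebraic l c := Algebra.IsAlgebraic.isAlgebraic c
    have h2 : IsAlgebraic l (algebraMap l' Q.ResidueField c) := h1.algebraMap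
    exact h2.tower_top (L := κ)
  set F₀ := Algebra.adjoin κ (Set.range (algebraMap l' Q.ResidueField)) with hF₀def
  have hF₀ : F₀ = (IntermediateField.adjoin κ
      (Set.range (algebraMap l' Q.ResidueField))).toSubalgebra :=
    (IntermediateField.adjoin_toSubalgebra_of_isAlgebraic halg).symm
  -- the image of `l′ ⊗ A` lies in `F₀`
  have himg : ∀ z : l' ⊗[l] A, algebraMap (l' ⊗[l] A) Q.ResidueField z ∈ F₀ := by
    intro z
    induction z using TensorProduct.induction_on with
    | zero => rw [map_zero]; exact zero_mem _
    | tmul c a =>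
      have hca : c ⊗ₜ[l] a = (c ⊗ₜ[l] (1 : A)) * ((1 : l') ⊗ₜ[l] a) := by
        rw [Algebra.TensorProduct.tmul_mul_tmul, mul_one, one_mul]
      rw [hca, map_mul]
      refine Subalgebra.mul_mem _ (Algebra.subset_adjoin ⟨c, ?_⟩) ?_
      · rw [IsScalarTower.algebraMap_apply l' (l' ⊗[l] A) Q.ResidueField,
          Algebra.TensorProduct.algebraMap_apply, Algebra.algebraMap_self, RingHom.id_apply]
      · have : ((1 : l') ⊗ₜ[l] a) = ι a := rfl
        rw [this, ← hρ]
        exact Subalgebra.algebraMap_mem _ _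
    | add z₁ z₂ h₁ h₂ => rw [map_add]; exact add_mem h₁ h₂
  -- every element of `κ(Q)` is a quotient of two such images
  rw [eq_top_iff]
  rintro e -
  obtain ⟨p, s, -, rfl⟩ := IsFractionRing.div_surjective (A := (l' ⊗[l] A) ⧸ Q) e
  obtain ⟨p, rfl⟩ := Ideal.Quotient.mk_surjective p
  obtain ⟨s, rfl⟩ := Ideal.Quotient.mk_surjective s
  rw [Ideal.algebraMap_quotient_residueField_mk, Ideal.algebraMap_quotient_residueField_mk]
  have hp : algebraMap _ Q.ResidueField p ∈
      IntermediateField.adjoin κ (Set.range (algebraMap l' Q.ResidueField)) := by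
    rw [← IntermediateField.mem_toSubalgebra, ← hF₀]; exact himg p
  have hs : algebraMap _ Q.ResidueField s ∈
      IntermediateField.adjoin κ (Set.range (algebraMap l' Q.ResidueField)) := by
    rw [← IntermediateField.mem_toSubalgebra, ← hF₀]; exact himg s
  change _ ∈ F₀
  rw [hF₀, IntermediateField.mem_toSubalgebra]
  exact div_mem hp hs

/-- **The residue field of the base change is separable when every compositum is**: if every
compositum of `κ(x)` with `l′` is formally smooth over `l′` (the output of
`exists_purelyInseparable_formallySmooth_compositum`), then so is the residue field `κ(Q)` of
`l′ ⊗_l A` at any prime `Q` over `x`. [folklore] -/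
theorem formallySmooth_residueField_baseChange_of_compositum [Algebra.IsAlgebraic l l']
    (hx : x = Q.comap (Algebra.TensorProduct.includeRight (R := l) (A := l') :
      A →ₐ[l] l' ⊗[l] A).toRingHom)
    (hsep : ∀ (F : Type u) [Field F] [Algebra x.ResidueField F] [Algebra l' F] [Algebra l F]
      [IsScalarTower l x.ResidueField F] [IsScalarTower l l' F],
      Algebra.adjoin x.ResidueField (Set.range (algebraMap l' F)) = ⊤ →
      Algebra.FormallySmooth l' F) :
    Algebra.FormallySmooth l' Q.ResidueField := by
  letI inst : Algebra x.ResidueField Q.ResidueField :=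
    (Ideal.ResidueField.map x Q (Algebra.TensorProduct.includeRight (R := l) (A := l') :
      A →ₐ[l] l' ⊗[l] A).toRingHom hx).toAlgebra
  haveI : IsScalarTower l x.ResidueField Q.ResidueField :=
    isScalarTower_residueField_baseChange A Q x hx
  haveI : IsScalarTower l l' Q.ResidueField := isScalarTower_left_residueField_baseChange A Q
  exact hsep Q.ResidueField (adjoin_residueField_baseChange_eq_top A Q x hx)

end ResidueFieldBaseChange

/-! ### Changing the base field along an isomorphism -/

/-- Formal smoothness over `R` is formal smoothness over any `R′ ≅ R` (compatibly with the
structure maps). [folklore] -/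
theorem formallySmooth_of_ringEquiv_base {R R' A : Type*} [CommRing R] [CommRing R']
    [CommRing A] [Algebra R A] [Algebra R' A] (e : R ≃+* R')
    (he : ∀ r, algebraMap R' A (e r) = algebraMap R A r) [Algebra.FormallySmooth R A] :
    Algebra.FormallySmooth R' A := by
  letI : Algebra R' R := e.symm.toRingHom.toAlgebra
  haveI : IsScalarTower R' R A := IsScalarTower.of_algebraMap_eq fun r' => by
    change algebraMap R' A r' = algebraMap R A (e.symm r')
    rw [← he, e.apply_symm_apply]
  haveI : Algebra.FormallySmooth R' R :=
    Algebra.FormallySmooth.of_equiv (AlgEquiv.ofRingEquiv (f := e.symm) fun _ => rfl)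
  exact Algebra.FormallySmooth.comp R' R A

end Literature.AlgebraicGeometry.Resolution

end
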